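import Literature.MathematicalPhysics.KineticTheory.RegularStationaryState
import Literature.Analysis.FunctionSpaces.PoissonPointProcessUniqueness
import Literature.Analysis.FunctionSpaces.PointConfigVagueTopology

/-!
# Tangent tightness, IV-a: compact count events and mixed moments of linear statistics (line `FirstLemma`, crux stmt-AtomisticToContinuum-14135)

Core (measure-theoretic) half of the proof of the registered stub `stub_laplaceFunctionalDeterminesLaw`
(`…TangentTightnessLaplaceUniqueness.lean`; Kallenberg, *Foundations of Modern Probability* (2002), Lemma 12.1 for
the tree's locally finite simple configurations `PointConfig X` with their count σ-algebra), namespace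
`Summit.AtomisticToContinuum.HydrodynamicLimit.Theorems.KiferCompactification`:

* `sumFn_eq_sum_inter`, `sumFn_sum_natCast_mul`: linear statistics `S_f(ω) = ∑_{p ∈ ω} f p` of `f` supported in a
  compact `L` are finite sums over `ω ∩ L`; `S_{∑ nₖ fₖ} = ∑ nₖ S_{fₖ}`;
* `sumFn_pow_succ_facts`: for `g : X → [0,1]` compactly supported with `K = g⁻¹{1}`, `S_{g^{n+1}}(ω) ↓ N_ω(K)`
  (counts of compact sets are monotone limits of linear statistics);
* `measurable_of_measurable_count_isCompact`: a map into configurations is measurable as soon as the counts of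
  compact sets are (λ-system argument on `X` run through the finite counting measures `(ω.toMeasure)|_L`,
  `Measurable.measure_of_isPiSystem`, then the compact exhaustion);
* `isPiSystem_compactCountEvents`, `stub_generateFrom_compactCountEvents` (REGISTERED helper stub): the events
  `{N(K₁) < t₁, …, N(Kₘ) < tₘ}` over compact sets form a π-system generating the count σ-algebra (Kallenberg
  Thm. A2.3: the σ-algebra of counting measures is generated by the counts of compact sets);
* `integral_prod_pow_exp_neg_sumFn_eq`: under equality of Laplace functionals on `C_c⁺`, all mixed moments of
  `(e^{-S_{f₁}}, …, e^{-S_{fₘ}})` agree (they are Laplace functionals at `∑ nₖ fₖ`); `laplaceFunctional_zero`.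

References: O. Kallenberg, *Foundations of Modern Probability*, 2nd ed. (2002), Lemma 12.1, Thm. A2.3;
D. J. Daley, D. Vere-Jones, *An Introduction to the Theory of Point Processes* II (2008), §9.1, Thm. 9.4.V.
-/

noncomputable section

open MeasureTheory Set Filter Topology Function
open scoped ENNReal NNReal BoundedContinuousFunction

namespace Summit.AtomisticToContinuum.HydrodynamicLimit.Theorems.KiferCompactification

open Literature.Analysis.FunctionSpaces (PointConfig)
open Literature.MathematicalPhysics.KineticTheory.PointProcess (laplaceFunctional measurable_exp_neg_finsum)

variable {X : Type*} [TopologicalSpace X]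

/-! ## Linear statistics as finite sums -/

/-- For `f` supported in a compact set `L`, the linear statistic `∑_{p ∈ ω} f p` is the finite sum over the
points of `ω` in `L`. -/
theorem sumFn_eq_sum_inter (ω : PointConfig X) {L : Set X} (hL : IsCompact L) {f : X → ℝ}
    (hf : support f ⊆ L) :
    ω.sumFn f = ∑ p ∈ (ω.finite_inter_isCompact L hL).toFinset, f p := by
  refine finsum_mem_eq_sum_of_subset f ?_ ?_
  · intro p hp
    rw [Finite.coe_toFinset]
    exact ⟨hp.1, hf hp.2⟩
  · intro p hp
    rw [Finite.coe_toFinset] at hp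
    exact hp.1

/-- Linear statistics of nonnegative-integer combinations of compactly supported functions:
`S_{∑ₖ nₖ fₖ} = ∑ₖ nₖ S_{fₖ}`. -/
theorem sumFn_sum_natCast_mul {κ : Type*} [Fintype κ] (ω : PointConfig X) {f : κ → X → ℝ}
    (hcs : ∀ k, HasCompactSupport (f k)) (n : κ → ℕ) :
    ω.sumFn (fun x => ∑ k, (n k : ℝ) * f k x) = ∑ k, (n k : ℝ) * ω.sumFn (f k) := by
  have hL : IsCompact (⋃ k, tsupport (f k)) := isCompact_iUnion fun k => (hcs k).isCompact
  have hsub : ∀ k, support (f k) ⊆ ⋃ k, tsupport (f k) := fun k =>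
    (subset_tsupport _).trans (subset_iUnion (fun k => tsupport (f k)) k)
  have hsub' : support (fun x => ∑ k, (n k : ℝ) * f k x) ⊆ ⋃ k, tsupport (f k) := by
    intro x hx
    obtain ⟨k, -, hk⟩ := Finset.exists_ne_zero_of_sum_ne_zero hx
    exact hsub k (right_ne_zero_of_mul hk)
  rw [sumFn_eq_sum_inter ω hL hsub', Finset.sum_comm]
  refine Finset.sum_congr rfl fun k _ => ?_
  rw [sumFn_eq_sum_inter ω hL (hsub k), Finset.mul_sum]

/-! ## Counts of compact sets as monotone limits of linear statistics -/

/-- Pointwise monotone approximation of counts: for `g : X → [0,1]` with compact support and `K = g⁻¹{1}`, the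
linear statistics `S_{g^{n+1}}(ω)` decrease (in `n`) to the number of points of `ω` in `K`; in particular
`S_{g^{n+1}}(ω) < t` forces `N_ω(K) < t`, and `N_ω(K) < t` forces `S_{g^{n+1}}(ω) < t` eventually. -/
theorem sumFn_pow_succ_facts (ω : PointConfig X) {K : Set X} {g : X → ℝ} (hgK : K = g ⁻¹' {1})
    (hgc : HasCompactSupport g) (hg01 : ∀ x, g x ∈ Icc (0 : ℝ) 1) (t : ℕ) :
    (Antitone fun n : ℕ => ω.sumFn fun x => g x ^ (n + 1)) ∧
      (∀ n : ℕ, (ω.sumFn fun x => g x ^ (n + 1)) < t → ω.count K < (t : ℕ∞)) ∧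
        (ω.count K < (t : ℕ∞) → ∀ᶠ n : ℕ in atTop, (ω.sumFn fun x => g x ^ (n + 1)) < t) := by
  classical
  -- the points of `ω` in the support of `g`
  set T : Finset X := (ω.finite_inter_isCompact _ hgc.isCompact).toFinset with hT
  have hsupp : ∀ n : ℕ, support (fun x => g x ^ (n + 1)) ⊆ tsupport g := fun n x hx =>
    subset_tsupport _ fun h' => hx (by simp [h'])
  have hu : ∀ n : ℕ, (ω.sumFn fun x => g x ^ (n + 1)) = ∑ p ∈ T, g p ^ (n + 1) := fun n =>
    sumFn_eq_sum_inter ω hgc.isCompact (hsupp n)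
  have hg1 : ∀ {p}, p ∈ K → g p = 1 := fun hp => by rwa [hgK] at hp
  have hKL : K ⊆ tsupport g := fun p hp => subset_tsupport _ (by simp [mem_support, hg1 hp])
  -- the number of points in `K`
  have hKT : ω.carrier ∩ K = ↑(T.filter (· ∈ K)) := by
    ext p
    simp only [hT, Finset.coe_filter, Finite.mem_toFinset, mem_inter_iff, mem_setOf_eq]
    exact ⟨fun h => ⟨⟨h.1, hKL h.2⟩, h.2⟩, fun h => ⟨h.1.1, h.2⟩⟩
  have hcount : ω.count K = ((T.filter (· ∈ K)).card : ℕ∞) := by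
    rw [PointConfig.count, hKT, encard_coe_eq_coe_finsetCard]
  -- convergence and domination of the finite sums
  have htend : Tendsto (fun n : ℕ => ∑ p ∈ T, g p ^ (n + 1)) atTop
      (𝓝 ((T.filter (· ∈ K)).card : ℝ)) := by
    rw [← Finset.sum_boole]  -- may need adjusting
    refine tendsto_finsetSum T fun p _ => ?_
    by_cases hp : p ∈ K
    · simp [hg1 hp, hp]
    · have hne : g p ≠ 1 := by rwa [hgK] at hp
      simp only [hp, if_false]
      exact (tendsto_pow_atTop_nhds_zero_of_lt_one (hg01 p).1 (lt_of_le_of_ne (hg01 p).2 hne)).comp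
        (tendsto_add_atTop_nat 1)
  have hle : ∀ n : ℕ, ((T.filter (· ∈ K)).card : ℝ) ≤ ∑ p ∈ T, g p ^ (n + 1) := by
    intro n
    rw [← Finset.sum_boole]
    refine Finset.sum_le_sum fun p _ => ?_
    by_cases hp : p ∈ K
    · simp [hg1 hp, hp]
    · simp only [hp, if_false]
      exact pow_nonneg (hg01 p).1 _
  refine ⟨?_, ?_, ?_⟩
  · intro m n hmn
    show (ω.sumFn fun x => g x ^ (n + 1)) ≤ ω.sumFn fun x => g x ^ (m + 1)
    rw [hu, hu]
    exact Finset.sum_le_sum fun p _ => pow_le_pow_of_le_one (hg01 p).1 (hg01 p).2 (by omega)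
  · intro n hn
    rw [hu n] at hn
    have h' : ((T.filter (· ∈ K)).card : ℝ) < t := (hle n).trans_lt hn
    rw [hcount]
    exact_mod_cast h'
  · intro hlt
    rw [hcount] at hlt
    have h' : ((T.filter (· ∈ K)).card : ℝ) < t := by exact_mod_cast hlt
    exact (htend.eventually_lt_const h').mono fun n hn => by rwa [hu n]

/-! ## Measurability from the counts of compact sets -/

section MeasurableOfCompact

variable [T2Space X] [SigmaCompactSpace X] [MeasurableSpace X] [BorelSpace X]

/-- An `ℕ∞`-valued map is measurable as soon as its composition with the coercion to `ℝ≥0∞` is. -/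
private theorem measurable_of_measurable_toENNReal {Ω : Type*} [MeasurableSpace Ω] {g : Ω → ℕ∞}
    (hg : Measurable fun a => ((g a : ℕ∞) : ℝ≥0∞)) : Measurable g :=
  measurable_to_countable' fun n => by
    have h : g ⁻¹' {n} = (fun a => ((g a : ℕ∞) : ℝ≥0∞)) ⁻¹' {(n : ℝ≥0∞)} := by
      ext a
      simp only [mem_preimage, mem_singleton_iff, ENat.toENNReal_inj]
    rw [h]
    exact hg (measurableSet_singleton _)

/-- Counts in the traces `s ∩ L` of Borel sets `s` on a fixed compact set `L` are measurable as soon as the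
counts of compact sets are: a λ-system argument on `X` (closed sets generate the Borel σ-algebra and meet `L`
in compact sets), run through the finite counting measures `a ↦ ((c a).toMeasure)|_L`. -/
theorem measurable_count_inter_of_isCompact {Ω : Type*} [MeasurableSpace Ω] {c : Ω → PointConfig X}
    (h : ∀ K, IsCompact K → Measurable fun a => (c a).count K) {L : Set X} (hL : IsCompact L)
    {s : Set X} (hs : MeasurableSet s) : Measurable fun a => (c a).count (s ∩ L) := by
  haveI hfin : ∀ a, IsFiniteMeasure (((c a).toMeasure).restrict L) := fun a => by
    refine ⟨?_⟩
    rw [Measure.restrict_apply MeasurableSet.univ, univ_inter,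
      PointConfig.toMeasure_apply _ hL.measurableSet, ENat.toENNReal_lt_top]
    exact (c a).count_lt_top_of_isCompact hL
  have hμ : Measurable fun a => ((c a).toMeasure).restrict L := by
    refine Measurable.measure_of_isPiSystem
      ((BorelSpace.measurable_eq (α := X)).trans borel_eq_generateFrom_isClosed) isPiSystem_isClosed
      (fun F hF => ?_) ?_
    · have hF' : IsClosed F := hF
      have hmeas : MeasurableSet F := hF'.measurableSet
      simp_rw [Measure.restrict_apply hmeas,
        PointConfig.toMeasure_apply _ (hmeas.inter hL.measurableSet)]
      exact measurable_from_top.comp (h _ (hL.inter_left hF'))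
    · simp_rw [Measure.restrict_apply MeasurableSet.univ, univ_inter,
        PointConfig.toMeasure_apply _ hL.measurableSet]
      exact measurable_from_top.comp (h _ hL)
  have h1 : Measurable fun a => ((c a).toMeasure).restrict L s := (Measure.measurable_coe hs).comp hμ
  simp_rw [Measure.restrict_apply hs, PointConfig.toMeasure_apply _ (hs.inter hL.measurableSet)] at h1
  exact measurable_of_measurable_toENNReal h1

/-- **A map into configurations is measurable as soon as the counts of compact sets are**: on a σ-compact
Hausdorff space the count σ-algebra of `PointConfig X` is generated by the counts of compact sets (counts of
Borel sets inside a compact `L` by `measurable_count_inter_of_isCompact`, then `N(s) = supₖ N(s ∩ Lₖ)` along the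
compact exhaustion). -/
theorem measurable_of_measurable_count_isCompact {Ω : Type*} [MeasurableSpace Ω]
    {c : Ω → PointConfig X} (h : ∀ K, IsCompact K → Measurable fun a => (c a).count K) :
    Measurable c := by
  refine PointConfig.measurable_of_count fun s hs => ?_
  have hG : ∀ n k : ℕ, MeasurableSet {a | (n : ℕ∞) ≤ (c a).count (s ∩ compactCovering X k)} :=
    fun n k => measurable_count_inter_of_isCompact h (isCompact_compactCovering X k) hs
      (show MeasurableSet {v : ℕ∞ | (n : ℕ∞) ≤ v} from (Set.to_countable _).measurableSet)
  have hG' : ∀ n : ℕ, MeasurableSet {a | (n : ℕ∞) ≤ (c a).count s} := by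
    intro n
    have : {a | (n : ℕ∞) ≤ (c a).count s} =
        ⋃ k, {a | (n : ℕ∞) ≤ (c a).count (s ∩ compactCovering X k)} := by
      ext a
      simp only [mem_setOf_eq, mem_iUnion]
      exact (c a).natCast_le_count_iff_exists s (compactCovering_subset X) (iUnion_compactCovering X) n
    rw [this]
    exact MeasurableSet.iUnion fun k => hG n k
  refine ENat.measurable_iff.2 fun n => ?_
  have : (fun a => (c a).count s) ⁻¹' {(n : ℕ∞)} =
      {a | (n : ℕ∞) ≤ (c a).count s} \ {a | ((n + 1 : ℕ) : ℕ∞) ≤ (c a).count s} := by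
    ext a
    simp only [mem_preimage, mem_singleton_iff, Set.mem_sdiff, mem_setOf_eq, not_le, Nat.cast_add,
      Nat.cast_one]
    constructor
    · intro ha
      rw [ha]
      exact ⟨le_rfl, by exact_mod_cast Nat.lt_succ_self n⟩
    · rintro ⟨h1, h2⟩
      exact le_antisymm ((ENat.lt_add_one_iff (ENat.coe_ne_top n)).1 h2) h1
  rw [this]
  exact (hG' n).diff (hG' (n + 1))

end MeasurableOfCompact

/-! ## The compact count events: a generating π-system -/

section Cylinders

/-- The events `{N(K₁) < t₁, …, N(Kₘ) < tₘ}` over finitely many compact sets form a π-system (concatenate the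
two families). -/
theorem isPiSystem_compactCountEvents :
    IsPiSystem {A : Set (PointConfig X) | ∃ (κ : Type) (_ : Fintype κ) (K : κ → Set X) (t : κ → ℕ),
      (∀ k, IsCompact (K k)) ∧ A = {ω | ∀ k, ω.count (K k) < (t k : ℕ∞)}} := by
  rintro A ⟨κ, hκ, K, t, hK, rfl⟩ A' ⟨κ', hκ', K', t', hK', rfl⟩ -
  refine ⟨κ ⊕ κ', inferInstance, Sum.elim K K', Sum.elim t t', ?_, ?_⟩
  · rintro (k | k)
    · exact hK k
    · exact hK' k
  · ext ω
    simp only [mem_inter_iff, mem_setOf_eq, Sum.forall, Sum.elim_inl, Sum.elim_inr]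

variable [MeasurableSpace X]

/-- Compact count events are measurable for the count σ-algebra. -/
theorem measurableSet_of_mem_compactCountEvents [T2Space X] [OpensMeasurableSpace X]
    {A : Set (PointConfig X)}
    (hA : A ∈ {A : Set (PointConfig X) | ∃ (κ : Type) (_ : Fintype κ) (K : κ → Set X) (t : κ → ℕ),
      (∀ k, IsCompact (K k)) ∧ A = {ω | ∀ k, ω.count (K k) < (t k : ℕ∞)}}) :
    MeasurableSet A := by
  obtain ⟨κ, hκ, K, t, hK, rfl⟩ := hA
  rw [Set.setOf_forall]
  exact MeasurableSet.iInter fun k =>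
    PointConfig.measurable_count (hK k).measurableSet
      (show MeasurableSet {v : ℕ∞ | v < (t k : ℕ∞)} from (Set.to_countable _).measurableSet)

/-- **The compact count events generate the count σ-algebra** of `PointConfig X`, for `X` σ-compact Hausdorff
with its Borel σ-algebra (`{N(K) = n} = {N(K) < n + 1} \ {N(K) < n}` and
`measurable_of_measurable_count_isCompact`). -/
theorem generateFrom_compactCountEvents [T2Space X] [SigmaCompactSpace X] [BorelSpace X] :
    MeasurableSpace.generateFrom {A : Set (PointConfig X) | ∃ (κ : Type) (_ : Fintype κ) (K : κ → Set X)
      (t : κ → ℕ), (∀ k, IsCompact (K k)) ∧ A = {ω | ∀ k, ω.count (K k) < (t k : ℕ∞)}} =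
      (PointConfig.instMeasurableSpace : MeasurableSpace (PointConfig X)) := by
  apply le_antisymm
  · exact MeasurableSpace.generateFrom_le fun A hA => measurableSet_of_mem_compactCountEvents hA
  · set C := {A : Set (PointConfig X) | ∃ (κ : Type) (_ : Fintype κ) (K : κ → Set X)
      (t : κ → ℕ), (∀ k, IsCompact (K k)) ∧ A = {ω | ∀ k, ω.count (K k) < (t k : ℕ∞)}} with hC
    -- counts of compact sets are measurable for the generated σ-algebra
    have hK : ∀ K, IsCompact K →
        Measurable[MeasurableSpace.generateFrom C] fun ω : PointConfig X => ω.count K := by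
      intro K hK
      have hlt : ∀ m : ℕ,
          MeasurableSet[MeasurableSpace.generateFrom C] {ω : PointConfig X | ω.count K < (m : ℕ∞)} := by
        intro m
        refine MeasurableSpace.measurableSet_generateFrom
          ⟨Unit, inferInstance, fun _ => K, fun _ => m, fun _ => hK, ?_⟩
        ext ω
        simp
      refine (@ENat.measurable_iff _ (MeasurableSpace.generateFrom C) _).2 fun n => ?_
      have : (fun ω : PointConfig X => ω.count K) ⁻¹' {(n : ℕ∞)} =
          {ω | ω.count K < ((n + 1 : ℕ) : ℕ∞)} \ {ω | ω.count K < (n : ℕ∞)} := by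
        ext ω
        simp only [mem_preimage, mem_singleton_iff, Set.mem_sdiff, mem_setOf_eq, not_lt, Nat.cast_add,
          Nat.cast_one]
        constructor
        · intro hω
          rw [hω]
          exact ⟨by exact_mod_cast Nat.lt_succ_self n, le_rfl⟩
        · rintro ⟨h1, h2⟩
          exact le_antisymm ((ENat.lt_add_one_iff (ENat.coe_ne_top n)).1 h1) h2
      rw [this]
      exact (hlt (n + 1)).diff (hlt n)
    have hid := @measurable_of_measurable_count_isCompact X _ _ _ _ _ (PointConfig X)
      (MeasurableSpace.generateFrom C) id hK
    intro s hs
    exact hid hs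

end Cylinders

/-! ## Mixed moments of the exponential statistics -/

section Moments

variable [MeasurableSpace X] {μ ν : Measure (PointConfig X)}

/-- The Laplace functional at `f = 0` is the total mass. -/
theorem laplaceFunctional_zero (ρ : Measure (PointConfig X)) :
    laplaceFunctional ρ (0 : X → ℝ) = ρ.real univ := by
  simp [laplaceFunctional]

/-- Under the Laplace hypothesis the mixed moments of `(e^{-S_{f_k}})_k` agree under `μ` and `ν`: they are the
Laplace functionals at `∑ₖ nₖ fₖ ∈ C_c⁺`. -/
theorem integral_prod_pow_exp_neg_sumFn_eq {κ : Type*} [Fintype κ]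
    (hL : ∀ f : X → ℝ, Continuous f → HasCompactSupport f → (∀ x, 0 ≤ f x) →
      laplaceFunctional μ f = laplaceFunctional ν f)
    {f : κ → X → ℝ} (hf : ∀ k, Continuous (f k)) (hcs : ∀ k, HasCompactSupport (f k))
    (h0 : ∀ k x, 0 ≤ f k x) (n : κ → ℕ) :
    ∫ ω, ∏ k, Real.exp (-(ω.sumFn (f k))) ^ n k ∂μ =
      ∫ ω, ∏ k, Real.exp (-(ω.sumFn (f k))) ^ n k ∂ν := by
  set g : X → ℝ := fun x => ∑ k, (n k : ℝ) * f k x with hg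
  have hgc : Continuous g := continuous_finsetSum _ fun k _ => continuous_const.mul (hf k)
  have hgs : HasCompactSupport g := by
    refine HasCompactSupport.intro' (isCompact_iUnion fun k => (hcs k).isCompact)
      (isClosed_iUnion_of_finite fun k => isClosed_tsupport _) fun x hx => ?_
    refine Finset.sum_eq_zero fun k _ => ?_
    have hxk : x ∉ tsupport (f k) := fun h' => hx (mem_iUnion.2 ⟨k, h'⟩)
    rw [image_eq_zero_of_notMem_tsupport hxk, mul_zero]
  have hg0 : ∀ x, 0 ≤ g x := fun x => Finset.sum_nonneg fun k _ => mul_nonneg (Nat.cast_nonneg _) (h0 k x)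
  have hpt : ∀ ω : PointConfig X,
      ∏ k, Real.exp (-(ω.sumFn (f k))) ^ n k = Real.exp (-(ω.sumFn g)) := by
    intro ω
    rw [hg, sumFn_sum_natCast_mul ω hcs n, ← Finset.sum_neg_distrib, Real.exp_sum]
    refine Finset.prod_congr rfl fun k _ => ?_
    rw [← Real.exp_nat_mul, mul_neg]
  simp_rw [hpt]
  exact hL g hgc hgs hg0

end Moments

/-! ## The registered helper stub -/

/-- **The compact count events generate the count σ-algebra** (registered helper stub
`stub_generateFrom_compactCountEvents` of line `FirstLemma`, crux stmt-AtomisticToContinuum-14135; Kallenberg 2002,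
Thm. A2.3: on a σ-compact Hausdorff space with its Borel σ-algebra, the σ-algebra of locally finite configurations
generated by all counts `N(s)`, `s` Borel, is already generated by the events `{N(K₁) < t₁, …, N(Kₘ) < tₘ}` over
compact sets). -/
theorem stub_generateFrom_compactCountEvents {Y : Type*} [TopologicalSpace Y] [T2Space Y]
    [SigmaCompactSpace Y] [MeasurableSpace Y] [BorelSpace Y] :
    MeasurableSpace.generateFrom {A : Set (PointConfig Y) | ∃ (κ : Type) (_ : Fintype κ) (K : κ → Set Y)
      (t : κ → ℕ), (∀ k, IsCompact (K k)) ∧ A = {ω | ∀ k, ω.count (K k) < (t k : ℕ∞)}} =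
      (PointConfig.instMeasurableSpace : MeasurableSpace (PointConfig Y)) :=
  generateFrom_compactCountEvents

end Summit.AtomisticToContinuum.HydrodynamicLimit.Theorems.KiferCompactification
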